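import Summits.ValiantsHypothesis.ValiantsHypothesis.Theorems.FeketeSOSFeketeSOSHardPaleyRIPHalfSpectrumFloor

/-!
# Route FeketeSOS — crux `FeketeSOSHard` (stmt-ValiantsHypothesis-3996), line `paley-rip` v3:
# spectral floors at two densities, and the concentration floor from bounded sum multiplicity

Part 1 (`…PaleyRIPHalfSpectrumFloor.lean`, p585258) is the symmetric case (both floors on halves) of census §6
(W1)–(W3) (`Cruxes/FeketeSOSHard/Lines/paley-rip-stub3-census.md`).  The census mechanism is asymmetric —
`κ_S(α_S(λ)) < 1 − m²/(W²λ)`: an ANTI-CONCENTRATION floor for one factor at SMALL density `σ` (every set of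
`≥ σN` frequencies carries `≥ e₁` of the energy: the small-value set of `|û|²` is smaller than `σN`) and a
CONCENTRATION floor for the other factor at the complementary density `1 − σ` (no set of `≤ σN` frequencies carries
more than `1 − e₂` of the energy).  This file proves

* `floor_product_two_density` — the abstract mechanism at densities `σ` / `1 − σ`:
  `e₁ e₂ (ΣX)(ΣY) ≤ N Σ XY` (`e₁ < 1`; no constraint on `σ`);
* `conv_energy_ge_of_spectralFloors` — `e₁ e₂ ‖u‖₂² ‖v‖₂² ≤ ‖u ⋆ v‖₂²` on `ℤ/N` (Plancherel + convolution theorem);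
* `sum_norm_dft_pow_four_le` — the concentration side is CHEAP: if `u` is supported in `T ⊆ ℤ/N` and every residue
  has at most `g` ordered representations as a sum of two elements of `T` (`g = 2` for Sidon sets), then
  `Σ_k |û(k)|⁴ ≤ g·N·‖u‖₂⁴ = (g/N)·(Σ_k |û(k)|²)²` (`Λ(4)`-constant `≤ g`; convolution theorem for `u ⋆ u`,
  Plancherel, Cauchy–Schwarz on fibres of size `≤ g`);
* `dft_energy_le_sqrt_of_card` / `dft_energy_floor_of_sumMultiplicity` — hence a set of `≤ σN` frequencies
  carries at most `√(gσ)` of the spectral energy, i.e. the floor `e₂ = 1 − √(gσ)` at density `1 − σ`.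

So on supports of bounded sum multiplicity the ONLY missing input of the census mechanism is the small-density
anti-concentration floor (census (W5a)); on `𝕋` it is a theorem for spectra of bounded difference multiplicity
(Zygmund 1948; Nazarov, Algebra i Analiz 5:4 (1993), effective constant `exp(D(ε,R)/m(E)^{2+ε})`), its `ℤ/p`
version is open.  Part `…PaleyRIPAntiConcentration.lean` draws the consequence for `stub_tameOperator` at `r = 2`.
Honest framing: conditional rungs; nothing here proves the stub, the engine, the crux, or anything about `VP ≠ VNP`.
-/

set_option linter.dupNamespace false

namespace Summit.ValiantsHypothesis.ValiantsHypothesis.Theorems.FeketeSOSHardPaleyRIP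

open Finset
open scoped BigOperators

noncomputable section

section TwoDensity

/-- **(W1)–(W3), two densities.**  `X, Y ≥ 0` on an `N`-set; `X` has the floor `e₁ < 1` on every set of size
`≥ σN` (anti-concentration of `X`), `Y` has the floor `e₂` on every set of size `≥ (1−σ)N` (non-concentration of
`Y`).  Then `e₁·e₂·(ΣX)(ΣY) ≤ N·Σ XY`.  Proof: level `t = e₁ΣX/N`; if `{X > t}` has size `≥ (1−σ)N` use the
`Y`-floor there; else `{X ≤ t}` has size `> σN`, the `X`-floor gives `e₁ΣX ≤ t·#{X ≤ t}`, forcing `X ≤ t`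
everywhere and `ΣX ≤ e₁ΣX`. [folklore] -/
theorem floor_product_two_density {ι : Type*} [Fintype ι] [DecidableEq ι] (X Y : ι → ℝ) (hX : ∀ i, 0 ≤ X i)
    (hY : ∀ i, 0 ≤ Y i) (σ e₁ e₂ : ℝ) (he₁ : 0 ≤ e₁) (he₁1 : e₁ < 1) (he₂ : 0 ≤ e₂)
    (hfX : ∀ B : Finset ι, σ * Fintype.card ι ≤ B.card → e₁ * ∑ i, X i ≤ ∑ i ∈ B, X i)
    (hfY : ∀ B : Finset ι, (1 - σ) * Fintype.card ι ≤ B.card → e₂ * ∑ i, Y i ≤ ∑ i ∈ B, Y i) :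
    e₁ * e₂ * (∑ i, X i) * (∑ i, Y i) ≤ (Fintype.card ι : ℝ) * ∑ i, X i * Y i := by
  set N : ℕ := Fintype.card ι with hNdef
  set TX : ℝ := ∑ i, X i with hTXdef
  set TY : ℝ := ∑ i, Y i with hTYdef
  have hTX0 : 0 ≤ TX := Finset.sum_nonneg fun i _ => hX i
  have hTY0 : 0 ≤ TY := Finset.sum_nonneg fun i _ => hY i
  have hP0 : 0 ≤ ∑ i, X i * Y i := Finset.sum_nonneg fun i _ => mul_nonneg (hX i) (hY i)
  have hRHS0 : 0 ≤ (N : ℝ) * ∑ i, X i * Y i := mul_nonneg (Nat.cast_nonneg _) hP0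
  rcases hTX0.lt_or_eq with hTXpos | hTX
  swap
  · rw [← hTX]; simpa using hRHS0
  rcases he₁.lt_or_eq with hepos | he
  swap
  · rw [← he]; simpa using hRHS0
  have hLHS0 : 0 ≤ e₁ * e₂ * TX * TY := by positivity
  have hNpos : 0 < N := by
    obtain ⟨i, -, _⟩ := Finset.exists_ne_zero_of_sum_ne_zero (ne_of_gt hTXpos)
    exact Fintype.card_pos_iff.2 ⟨i⟩
  have hNpos' : (0 : ℝ) < N := by exact_mod_cast hNpos
  set t : ℝ := e₁ * TX / N with htdef
  have htpos : 0 < t := by positivity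
  have hNt : (N : ℝ) * t = e₁ * TX := by rw [htdef]; field_simp
  set Lc : Finset ι := Finset.univ.filter (fun i => t < X i) with hLcdef
  set L : Finset ι := Finset.univ.filter (fun i => X i ≤ t) with hLdef
  have hLL : L.card + Lc.card = N := by
    have h := Finset.card_filter_add_card_filter_not (s := (Finset.univ : Finset ι)) (fun i => X i ≤ t)
    rw [Finset.card_univ] at h
    have hLc : (Finset.univ.filter fun i => ¬ X i ≤ t) = Lc := by
      rw [hLcdef]; congr 1; ext i; simp [not_le]
    rw [hLc] at h
    exact h
  have hLL' : (L.card : ℝ) + Lc.card = N := by exact_mod_cast hLL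
  by_cases hcase : (1 - σ) * (N : ℝ) ≤ Lc.card
  · -- Case A: the `Y`-floor on `{X > t}`
    have hYf := hfY Lc hcase
    have h1 : t * ∑ i ∈ Lc, Y i ≤ ∑ i ∈ Lc, X i * Y i := by
      rw [Finset.mul_sum]
      refine Finset.sum_le_sum fun i hi => ?_
      exact mul_le_mul_of_nonneg_right (le_of_lt (Finset.mem_filter.1 hi).2) (hY i)
    have h2 : ∑ i ∈ Lc, X i * Y i ≤ ∑ i, X i * Y i :=
      Finset.sum_le_sum_of_subset_of_nonneg (Finset.subset_univ _) fun i _ _ => mul_nonneg (hX i) (hY i)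
    calc e₁ * e₂ * TX * TY = (N * t) * (e₂ * TY) := by rw [hNt]; ring
      _ ≤ (N * t) * ∑ i ∈ Lc, Y i := mul_le_mul_of_nonneg_left hYf (by positivity)
      _ = N * (t * ∑ i ∈ Lc, Y i) := by ring
      _ ≤ N * ∑ i, X i * Y i := mul_le_mul_of_nonneg_left (h1.trans h2) hNpos'.le
  · -- Case B: the `X`-floor on `{X ≤ t}` is contradictory
    exfalso
    have hLbig : σ * (N : ℝ) ≤ L.card := by
      push Not at hcase
      linarith
    have hXf := hfX L hLbig
    have hsumL : ∑ i ∈ L, X i ≤ t * L.card := by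
      have : ∑ i ∈ L, X i ≤ ∑ _i ∈ L, t := Finset.sum_le_sum fun i hi => (Finset.mem_filter.1 hi).2
      rwa [Finset.sum_const, nsmul_eq_mul, mul_comm] at this
    by_cases hLc0 : Lc.card = 0
    · -- `X ≤ t` everywhere: `TX ≤ N t = e₁ TX < TX`
      have hall : ∀ i, X i ≤ t := by
        intro i
        by_contra hi
        have hmem : i ∈ Lc := Finset.mem_filter.2 ⟨Finset.mem_univ i, not_le.1 hi⟩
        rw [Finset.card_eq_zero] at hLc0
        rw [hLc0] at hmem
        exact Finset.notMem_empty i hmem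
      have hTXle : TX ≤ N * t := by
        have : ∑ i, X i ≤ ∑ _i : ι, t := Finset.sum_le_sum fun i _ => hall i
        rwa [Finset.sum_const, Finset.card_univ, nsmul_eq_mul] at this
      rw [hNt] at hTXle
      nlinarith
    · have hLlt : (L.card : ℝ) < N := by
        have : 0 < Lc.card := Nat.pos_of_ne_zero hLc0
        have : (0 : ℝ) < Lc.card := by exact_mod_cast this
        linarith
      have : e₁ * TX < e₁ * TX := by
        calc e₁ * TX ≤ ∑ i ∈ L, X i := hXf
          _ ≤ t * L.card := hsumL
          _ < t * N := mul_lt_mul_of_pos_left hLlt htpos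
          _ = e₁ * TX := by rw [mul_comm, hNt]
      exact lt_irrefl _ this

end TwoDensity

section Fourier

open Literature.Analysis.Quadrature

variable {N : ℕ} [NeZero N]

/-- **No near-zero-divisor pair from two spectral floors.**  If `|û|²` (`û = ZMod.dft u`) has the
anti-concentration floor `e₁ < 1` at density `σ` and `|v̂|²` the concentration floor `e₂` at density `1 − σ`, then
`e₁·e₂·‖u‖₂²·‖v‖₂² ≤ ‖u ⋆ v‖₂²` (cyclic convolution on `ℤ/N`). [folklore] -/
theorem conv_energy_ge_of_spectralFloors (σ e₁ e₂ : ℝ) (he₁ : 0 ≤ e₁) (he₁1 : e₁ < 1) (he₂ : 0 ≤ e₂)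
    (u v : ZMod N → ℂ)
    (hu : ∀ B : Finset (ZMod N), σ * N ≤ B.card →
      e₁ * ∑ k, ‖ZMod.dft u k‖ ^ 2 ≤ ∑ k ∈ B, ‖ZMod.dft u k‖ ^ 2)
    (hv : ∀ B : Finset (ZMod N), (1 - σ) * N ≤ B.card →
      e₂ * ∑ k, ‖ZMod.dft v k‖ ^ 2 ≤ ∑ k ∈ B, ‖ZMod.dft v k‖ ^ 2) :
    e₁ * e₂ * (∑ j, ‖u j‖ ^ 2) * (∑ j, ‖v j‖ ^ 2) ≤ ∑ n, ‖cyclicConv u v n‖ ^ 2 := by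
  classical
  have hN : (0 : ℝ) < N := by exact_mod_cast Nat.pos_of_ne_zero (NeZero.ne N)
  have hcard : Fintype.card (ZMod N) = N := ZMod.card N
  have hfp := floor_product_two_density (fun k => ‖ZMod.dft u k‖ ^ 2) (fun k => ‖ZMod.dft v k‖ ^ 2)
    (fun k => sq_nonneg _) (fun k => sq_nonneg _) σ e₁ e₂ he₁ he₁1 he₂
    (fun B hB => hu B (by rwa [hcard] at hB)) (fun B hB => hv B (by rwa [hcard] at hB))
  rw [hcard] at hfp
  have hPu := Literature.Analysis.Fourier.sum_norm_sq_dft u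
  have hPv := Literature.Analysis.Fourier.sum_norm_sq_dft v
  have hPc := Literature.Analysis.Fourier.sum_norm_sq_dft (cyclicConv u v)
  have hprod : ∑ k, ‖ZMod.dft u k‖ ^ 2 * ‖ZMod.dft v k‖ ^ 2 = ∑ k, ‖ZMod.dft (cyclicConv u v) k‖ ^ 2 := by
    refine Finset.sum_congr rfl fun k _ => ?_
    rw [dft_cyclicConv, norm_mul, mul_pow]
  rw [hPu, hPv, hprod, hPc] at hfp
  have hN2 : (0 : ℝ) < (N : ℝ) * N := mul_pos hN hN
  have key : (N : ℝ) * N * (e₁ * e₂ * (∑ j, ‖u j‖ ^ 2) * (∑ j, ‖v j‖ ^ 2)) ≤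
      (N : ℝ) * N * ∑ n, ‖cyclicConv u v n‖ ^ 2 := by
    have h := hfp
    ring_nf
    ring_nf at h
    linarith
  exact le_of_mul_le_mul_left key hN2

/-- **`Λ(4)` from bounded sum multiplicity.**  If `u` vanishes off `T ⊆ ℤ/N` and every residue `r` has at most
`g` elements `j ∈ T` with `r − j ∈ T` (ordered representations as a sum of two elements of `T`; `g = 2` for a
Sidon set), then `Σ_k |û(k)|⁴ ≤ g·N·(Σ_j |u_j|²)²`.  Proof: `|û|⁴ = |𝓕(u ⋆ u)|²` (convolution theorem),
Plancherel, and Cauchy–Schwarz on the `≤ g` nonzero terms of each `(u ⋆ u)(r)`. [folklore] -/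
theorem sum_norm_dft_pow_four_le (T : Finset (ZMod N)) (g : ℕ) (u : ZMod N → ℂ)
    (hu : ∀ j, j ∉ T → u j = 0) (hg : ∀ r : ZMod N, (T.filter (fun j => r - j ∈ T)).card ≤ g) :
    ∑ k, ‖ZMod.dft u k‖ ^ 4 ≤ (g : ℝ) * N * (∑ j, ‖u j‖ ^ 2) ^ 2 := by
  classical
  -- `Σ |û|⁴ = Σ |𝓕(u⋆u)|² = N Σ_r |(u⋆u)(r)|²`
  have h4 : ∑ k, ‖ZMod.dft u k‖ ^ 4 = ∑ k, ‖ZMod.dft (cyclicConv u u) k‖ ^ 2 := by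
    refine Finset.sum_congr rfl fun k _ => ?_
    rw [dft_cyclicConv, norm_mul]; ring
  rw [h4, Literature.Analysis.Fourier.sum_norm_sq_dft (cyclicConv u u)]
  -- each `(u⋆u)(r)` is a sum over the fibre `F_r = {j ∈ T : r - j ∈ T}` of size `≤ g`
  have hfib : ∀ r : ZMod N, cyclicConv u u r = ∑ j ∈ T.filter (fun j => r - j ∈ T), u j * u (r - j) := by
    intro r
    unfold cyclicConv
    symm
    refine Finset.sum_subset (Finset.subset_univ _) fun j _ hj => ?_
    rw [Finset.mem_filter, not_and_or] at hj
    rcases hj with hj | hj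
    · rw [hu j hj, zero_mul]
    · rw [hu (r - j) hj, mul_zero]
  have hCS : ∀ r : ZMod N, ‖cyclicConv u u r‖ ^ 2 ≤ (g : ℝ) * ∑ j, ‖u j‖ ^ 2 * ‖u (r - j)‖ ^ 2 := by
    intro r
    set F := T.filter (fun j => r - j ∈ T) with hFdef
    rw [hfib r]
    calc ‖∑ j ∈ F, u j * u (r - j)‖ ^ 2 ≤ (∑ j ∈ F, ‖u j * u (r - j)‖) ^ 2 :=
          pow_le_pow_left₀ (norm_nonneg _) (norm_sum_le _ _) 2
      _ ≤ F.card * ∑ j ∈ F, ‖u j * u (r - j)‖ ^ 2 := sq_sum_le_card_mul_sum_sq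
      _ ≤ (g : ℝ) * ∑ j ∈ F, ‖u j * u (r - j)‖ ^ 2 :=
          mul_le_mul_of_nonneg_right (by exact_mod_cast hg r) (Finset.sum_nonneg fun j _ => sq_nonneg _)
      _ ≤ (g : ℝ) * ∑ j, ‖u j‖ ^ 2 * ‖u (r - j)‖ ^ 2 := by
          refine mul_le_mul_of_nonneg_left ?_ (Nat.cast_nonneg _)
          have : ∑ j ∈ F, ‖u j * u (r - j)‖ ^ 2 = ∑ j ∈ F, ‖u j‖ ^ 2 * ‖u (r - j)‖ ^ 2 :=
            Finset.sum_congr rfl fun j _ => by rw [norm_mul, mul_pow]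
          rw [this]
          exact Finset.sum_le_sum_of_subset_of_nonneg (Finset.subset_univ _)
            fun j _ _ => mul_nonneg (sq_nonneg _) (sq_nonneg _)
  -- sum over `r`, swap, reindex `r ↦ r - j`
  have hswap : ∑ r, ∑ j, ‖u j‖ ^ 2 * ‖u (r - j)‖ ^ 2 = (∑ j, ‖u j‖ ^ 2) ^ 2 := by
    rw [Finset.sum_comm, sq, Finset.sum_mul]
    refine Finset.sum_congr rfl fun j _ => ?_
    rw [← Finset.mul_sum]
    congr 1
    exact (Equiv.subRight j).sum_comp (fun x => ‖u x‖ ^ 2)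
  have hN0 : (0 : ℝ) ≤ N := Nat.cast_nonneg _
  calc (N : ℝ) * ∑ r, ‖cyclicConv u u r‖ ^ 2 ≤ (N : ℝ) * ∑ r, (g : ℝ) * ∑ j, ‖u j‖ ^ 2 * ‖u (r - j)‖ ^ 2 :=
        mul_le_mul_of_nonneg_left (Finset.sum_le_sum fun r _ => hCS r) hN0
    _ = (g : ℝ) * N * (∑ j, ‖u j‖ ^ 2) ^ 2 := by rw [← Finset.mul_sum, hswap]; ring

/-- **Concentration bound** from `Λ(4)`: under the hypotheses of `sum_norm_dft_pow_four_le`, every set `B` of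
frequencies carries at most `√(g·#B/N)` of the spectral energy: `Σ_{k∈B}|û(k)|² ≤ √(g #B / N)·Σ_k |û(k)|²`.
[folklore] -/
theorem dft_energy_le_sqrt_of_card (T : Finset (ZMod N)) (g : ℕ) (u : ZMod N → ℂ)
    (hu : ∀ j, j ∉ T → u j = 0) (hg : ∀ r : ZMod N, (T.filter (fun j => r - j ∈ T)).card ≤ g)
    (B : Finset (ZMod N)) :
    ∑ k ∈ B, ‖ZMod.dft u k‖ ^ 2 ≤ Real.sqrt ((g : ℝ) * B.card / N) * ∑ k, ‖ZMod.dft u k‖ ^ 2 := by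
  classical
  have hN : (0 : ℝ) < N := by exact_mod_cast Nat.pos_of_ne_zero (NeZero.ne N)
  have hP := Literature.Analysis.Fourier.sum_norm_sq_dft u
  have h4 := sum_norm_dft_pow_four_le T g u hu hg
  -- `(Σ_B X)² ≤ #B Σ_B X² ≤ #B Σ X² = #B Σ|û|⁴ ≤ #B g N (Σ|u|²)² = (#B g / N) (Σ_k X)²`
  have hsq : (∑ k ∈ B, ‖ZMod.dft u k‖ ^ 2) ^ 2 ≤ ((g : ℝ) * B.card / N) * (∑ k, ‖ZMod.dft u k‖ ^ 2) ^ 2 := by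
    calc (∑ k ∈ B, ‖ZMod.dft u k‖ ^ 2) ^ 2 ≤ B.card * ∑ k ∈ B, (‖ZMod.dft u k‖ ^ 2) ^ 2 :=
          sq_sum_le_card_mul_sum_sq
      _ ≤ B.card * ∑ k, ‖ZMod.dft u k‖ ^ 4 := by
          refine mul_le_mul_of_nonneg_left ?_ (Nat.cast_nonneg _)
          have : ∑ k ∈ B, (‖ZMod.dft u k‖ ^ 2) ^ 2 = ∑ k ∈ B, ‖ZMod.dft u k‖ ^ 4 :=
            Finset.sum_congr rfl fun k _ => by ring
          rw [this]
          exact Finset.sum_le_sum_of_subset_of_nonneg (Finset.subset_univ _) fun k _ _ => by positivity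
      _ ≤ B.card * ((g : ℝ) * N * (∑ j, ‖u j‖ ^ 2) ^ 2) := mul_le_mul_of_nonneg_left h4 (Nat.cast_nonneg _)
      _ = ((g : ℝ) * B.card / N) * ((N : ℝ) * ∑ j, ‖u j‖ ^ 2) ^ 2 := by field_simp
      _ = ((g : ℝ) * B.card / N) * (∑ k, ‖ZMod.dft u k‖ ^ 2) ^ 2 := by rw [hP]
  have hS0 : 0 ≤ ∑ k ∈ B, ‖ZMod.dft u k‖ ^ 2 := Finset.sum_nonneg fun k _ => sq_nonneg _
  have hT0 : 0 ≤ ∑ k, ‖ZMod.dft u k‖ ^ 2 := Finset.sum_nonneg fun k _ => sq_nonneg _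
  have hc0 : 0 ≤ (g : ℝ) * B.card / N := by positivity
  calc ∑ k ∈ B, ‖ZMod.dft u k‖ ^ 2 = Real.sqrt ((∑ k ∈ B, ‖ZMod.dft u k‖ ^ 2) ^ 2) := (Real.sqrt_sq hS0).symm
    _ ≤ Real.sqrt (((g : ℝ) * B.card / N) * (∑ k, ‖ZMod.dft u k‖ ^ 2) ^ 2) := Real.sqrt_le_sqrt hsq
    _ = Real.sqrt ((g : ℝ) * B.card / N) * ∑ k, ‖ZMod.dft u k‖ ^ 2 := by
        rw [Real.sqrt_mul hc0, Real.sqrt_sq hT0]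

/-- **The concentration floor at density `1 − σ` from bounded sum multiplicity.**  Under the hypotheses of
`sum_norm_dft_pow_four_le`, for every real `σ`: every `B ⊆ ℤ/N` with `#B ≥ (1−σ)N` carries at least `1 − √(gσ)` of the
spectral energy of `u`. [folklore] -/
theorem dft_energy_floor_of_sumMultiplicity (T : Finset (ZMod N)) (g : ℕ) (u : ZMod N → ℂ)
    (hu : ∀ j, j ∉ T → u j = 0) (hg : ∀ r : ZMod N, (T.filter (fun j => r - j ∈ T)).card ≤ g)
    (σ : ℝ) (B : Finset (ZMod N)) (hB : (1 - σ) * N ≤ B.card) :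
    (1 - Real.sqrt (g * σ)) * ∑ k, ‖ZMod.dft u k‖ ^ 2 ≤ ∑ k ∈ B, ‖ZMod.dft u k‖ ^ 2 := by
  classical
  have hN : (0 : ℝ) < N := by exact_mod_cast Nat.pos_of_ne_zero (NeZero.ne N)
  have hT0 : 0 ≤ ∑ k, ‖ZMod.dft u k‖ ^ 2 := Finset.sum_nonneg fun k _ => sq_nonneg _
  -- the complement has `≤ σN` elements
  have hsplit : ∑ k ∈ B, ‖ZMod.dft u k‖ ^ 2 = ∑ k, ‖ZMod.dft u k‖ ^ 2 - ∑ k ∈ Bᶜ, ‖ZMod.dft u k‖ ^ 2 := by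
    rw [← Finset.sum_add_sum_compl B]; ring
  have hcardc : ((Bᶜ).card : ℝ) ≤ σ * N := by
    have h := Finset.card_compl B
    rw [ZMod.card] at h
    have hBN : B.card ≤ N := by
      have := Finset.card_le_univ B; rwa [ZMod.card] at this
    have : ((Bᶜ).card : ℝ) = N - B.card := by
      rw [h, Nat.cast_sub hBN]
    rw [this]; linarith
  have hcomp := dft_energy_le_sqrt_of_card T g u hu hg Bᶜ
  have hroot : Real.sqrt ((g : ℝ) * (Bᶜ).card / N) ≤ Real.sqrt (g * σ) := by
    refine Real.sqrt_le_sqrt ?_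
    rw [div_le_iff₀ hN]
    have hg0 : (0 : ℝ) ≤ g := Nat.cast_nonneg _
    nlinarith [hcardc]
  rw [hsplit]
  have : ∑ k ∈ Bᶜ, ‖ZMod.dft u k‖ ^ 2 ≤ Real.sqrt (g * σ) * ∑ k, ‖ZMod.dft u k‖ ^ 2 :=
    hcomp.trans (mul_le_mul_of_nonneg_right hroot hT0)
  linarith

end Fourier

end

end Summit.ValiantsHypothesis.ValiantsHypothesis.Theorems.FeketeSOSHardPaleyRIP
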